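import Mathlib
import HarnessLib
import Literature.Analysis.FluidPDE.LocalForecastCorrector
import Literature.Analysis.FluidPDE.ConfinedHardSphereFlow
import Summits.AtomisticToContinuum.HydrodynamicLimit.Theses.AntiMazurCoboundaries

/-!
Sketch for crux-ideate `stmt-AtomisticToContinuum-13916` (InfluenceLocality), ideator 1, round 1
(rev. 2, gen-2 seat). First lemmas of the three idea cards, stated over existing declarations;
`kickDichotomy_holds`, `relay_meeting_span` and `relay_span` are proved, the rest are statements.
-/

namespace Summit.AtomisticToContinuum.HydrodynamicLimit.Cruxes.InfluenceLocality.Ideator1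

open MeasureTheory Set
open scoped BigOperators

open Literature.Analysis.FluidPDE Literature.MathematicalPhysics.KineticTheory

/-! ### Card `jensen-static-pressures` -/

/-- FIRST LEMMA (card jensen-static-pressures, conversion step): **Jensen in time under an
invariant law.** For a hard-sphere flow on `𝕋³`, a `Φ`-invariant probability law `μ` carried by
the good set and a bounded measurable phase function `a`, the exponential moment of the
time-INTEGRATED functional `∫₀ᵀ a ∘ Φ_s ds` is bounded by the STATIC exponential moment of `T·a`:
`∫ exp(∫₀ᵀ a(Φ_s z) ds) dμ ≤ ∫ exp(T a(z)) dμ` (write the inner integral as an average over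
`s ∈ [0,T]` of `T a(Φ_s z)`, Jensen for `exp`, Tonelli, invariance). This is the engine that turns
every kinematic budget of an influence chain (near-contact pair time, suprathermal kinetic time)
into an equal-time Gibbs pressure. -/
def JensenInTime : Prop :=
  ∀ (ε : ℝ) (N : ℕ)
    (Φ : HardSphereFlow (Torus.geometry (Fin 3)) ε (N + 1))
    (μ : Measure (Config (N + 1) (Fin 3) T3)),
    IsProbabilityMeasure μ → (∀ t, MeasurePreserving (Φ.flow t) μ μ) → μ Φ.goodᶜ = 0 →
    ∀ (a : Config (N + 1) (Fin 3) T3 → ℝ), Measurable a → (∃ C : ℝ, ∀ z, |a z| ≤ C) →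
    ∀ T : ℝ, 0 < T →
      ∫⁻ z, ENNReal.ofReal (Real.exp (∫ s in (0 : ℝ)..T, a (Φ.flow s z))) ∂μ
        ≤ ∫⁻ z, ENNReal.ofReal (Real.exp (T * a z)) ∂μ

/-- FIRST LEMMA (card jensen-static-pressures, kinematic step): **gap–speed Lipschitz bound.**
Along a hard-sphere trajectory on `𝕋³`, if particles `i ≠ j` are in contact at time `t` and both
have speed at most `w` on `[t - τ, t]`, then during that whole window their centres were within
`ε + 2 w τ` of each other (minimal-image distance): a collision between SLOW particles is preceded
by a near-contact episode of duration `≥ gap/(2w)`. Consequently the number of slow links of any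
influence chain in `[0, T]` is dominated by `(2w/g) · ∫₀ᵀ #{pairs at gap ≤ g} dt`, an additive
functional to which `JensenInTime` applies. -/
def GapLipschitz : Prop :=
  ∀ (ε : ℝ) (N : ℕ) (γ : ℝ → Config N (Fin 3) T3),
    IsHardSphereTrajectory (Torus.geometry (Fin 3)) ε N γ →
    ∀ (i j : Fin N) (t τ w : ℝ), i ≠ j → 0 ≤ τ → 0 ≤ w →
      γ t ∈ contactSet (Torus.geometry (Fin 3)) N ε i j →
      (∀ s ∈ Icc (t - τ) t, ‖(γ s i).2‖ ≤ w ∧ ‖(γ s j).2‖ ≤ w) →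
      ∀ s ∈ Icc (t - τ) t,
        ‖(Torus.geometry (Fin 3)).sepVec (γ s i).1 (γ s j).1‖ ≤ ε + 2 * w * τ

/-! ### Card `walled-cell-shadows` -/

/-- A SPHERICAL CAVITY as a wall for the sphere CENTRES: admissible region the closed ball
`‖x - a‖ ≤ ρ` (minimal image), contact on the sphere `‖x - a‖ = ρ`, inner normal `-(x-a)/ρ`
(pointing into the cavity). The reflecting vessel of Alexander's partial flows `T_r`
(Alexander 1976 §4; CIP 1994 §4.2: smooth `∂Λ`). Dual to the tree's `Wall.ball` (round scatterer). -/
noncomputable def cavity {d : Type*} [Fintype d] {X : Type*} (G : Geometry d X) (a : X) (ρ : ℝ)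
    (hρ : 0 < ρ) : Wall d X where
  region := {x | ‖G.sepVec x a‖ ≤ ρ}
  contact := {x | ‖G.sepVec x a‖ = ρ}
  contact_subset x hx := by
    simp only [mem_setOf_eq] at hx ⊢
    rw [hx]
  normal x := -(ρ⁻¹ • G.sepVec x a)
  norm_normal x hx := by
    simp only [mem_setOf_eq] at hx
    rw [norm_neg, norm_smul, norm_inv, Real.norm_eq_abs, abs_of_pos hρ, hx, inv_mul_cancel₀ hρ.ne']

/-- FIRST LEMMA (card walled-cell-shadows): **free = walled until first wall contact.**
Let `Ψ` be the free hard-sphere flow of `k` spheres on `𝕋³` and `Ξ` the flow of the same spheres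
confined in the spherical cavity of radius `ρ` about `a` (specular wall). If a datum `w` is good
for both and along the CONFINED orbit no centre reaches the wall during `[0, T]`, then the two
orbits coincide on `[0, T]` (forward uniqueness of hard-sphere trajectories: a confined trajectory
without wall events is a hard-sphere trajectory on that window). Hence every event about the
free forecast cluster on `[0,T]` is the same event about the STATIONARY walled cluster, up to the
escape event, which is itself an event of the walled world. -/
def FreeEqWalledUntilExit : Prop :=
  ∀ (ε ρ : ℝ) (hρ : 0 < ρ) (a : T3) (k : ℕ)
    (Ψ : HardSphereFlow (Torus.geometry (Fin 3)) ε k)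
    (Ξ : ConfinedHardSphereFlow (Torus.geometry (Fin 3))
      (fun _ : Unit => cavity (Torus.geometry (Fin 3)) a ρ hρ) ε k)
    (w : Config k (Fin 3) T3), w ∈ Ψ.good → w ∈ Ξ.good →
    ∀ T : ℝ, 0 ≤ T →
      (∀ t ∈ Icc 0 T, ∀ i : Fin k, ‖(Torus.geometry (Fin 3)).sepVec ((Ξ.flow t w i).1) a‖ < ρ) →
      ∀ t ∈ Icc 0 T, Ψ.flow t w = Ξ.flow t w

/-! ### Card `blast-front-energy` -/

/-- FIRST LEMMA (card blast-front-energy, necessity side): **kick dichotomy.** If two initial data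
`z, z'` give particle `i` the same range-`R` cluster and agree on it, but the TRUE orbits of `i`
differ at some time in `[0, T]` (e.g. `z'` = `z` with one far-away particle made fast: a planted
hot intruder whose blast reaches `i`), then `i` is a bad particle (true state ≠ local forecast)
for `z` or for `z'` — because both data have the SAME local forecast (`localClusterState_congr`).
This converts blast yields (particles moved by a kick of energy `E`) into lower bounds on the
bad count, and is the deterministic core of the planted-intruder lower bound
`lam* ≤ liminf_E E/(θ·Yield(E,T))`. -/
def KickDichotomy : Prop :=
  ∀ (ε : ℝ) (N : ℕ)
    (Φ : HardSphereFlow (Torus.geometry (Fin 3)) ε N)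
    (Ψ : (k : ℕ) → HardSphereFlow (Torus.geometry (Fin 3)) ε k)
    (R T : ℝ) (z z' : Config N (Fin 3) T3) (i : Fin N),
    rangeCluster (Torus.geometry (Fin 3)) R z i = rangeCluster (Torus.geometry (Fin 3)) R z' i →
    (∀ j ∈ rangeCluster (Torus.geometry (Fin 3)) R z i, z j = z' j) →
    (∃ t ∈ Icc 0 T, Φ.flow t z i ≠ Φ.flow t z' i) →
      (∃ t ∈ Icc 0 T, Φ.flow t z i ≠ localClusterState Ψ R t z i) ∨
      (∃ t ∈ Icc 0 T, Φ.flow t z' i ≠ localClusterState Ψ R t z' i)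

/-- `KickDichotomy` is immediate from `localClusterState_congr` (recorded to show the necessity
line starts from tree facts). -/
theorem kickDichotomy_holds : KickDichotomy := by
  intro ε N Φ Ψ R T z z' i hS hz ⟨t, ht, hne⟩
  by_contra h
  push Not at h
  obtain ⟨h1, h2⟩ := h
  have e1 := h1 t ht
  have e2 := h2 t ht
  have := localClusterState_congr Ψ hS hz t
  exact hne (by rw [e1, this, ← e2])

/-- Sanity: the crux decl is in scope by name (the cards aim at exactly this statement). -/
example : Prop := Summit.AtomisticToContinuum.HydrodynamicLimit.Theses.AntiMazurCoboundaries.InfluenceLocality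


/-! ### Gen-2 additions (seat planner-cruxidea-stmt-AtomisticToContinuum-13916-1-g2-0)

Two kernel-checked kinematic facts and one generic measure-theoretic statement that the revised
cards lean on.

(1) `relay_meeting_span` / `relay_span` — **RELAY KINEMATICS** (answers `Disproof.lean`, finding
4(a) "relay chains"). A *relay row* is a sequence of particles `p₀, p₁, …` with initial positions
`x k`, free-flight velocities `v k` (speeds `≤ w`) and scheduled pair meetings of `(p_{k}, p_{k+1})`
at NON-DECREASING times `t (k+1) ∈ [0, T]` (time-ordering is forced: whether link `k+1` fires
depends on whether `p_k` was deflected at link `k`). The meeting condition is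
`‖(x k + t(k+1)•v k) − (x(k+1) + t(k+1)•v(k+1))‖ ≤ ε` (contact, `ε` = diameter). CONCLUSION: all
meeting points lie within `n ε + w (t(n+1) − t 1) ≤ n ε + w T` of the first one, and every row
member STARTS within `3 w T + (n+1) ε` of `p₀`. Hence a relay row of thermal particles cannot
make a particle bad at range `R > 3 w T + (n+1) ε`: the discrepancy does NOT "sit at distance
n(σ + v̄T)" as claimed in `Disproof.lean` 4(a); the correct budget is rattack's
`reach ≤ v_max·T + σ·#links` (with `v_max` over carriers of EITHER world), i.e. long reach at
thermal speeds needs `#links ≍ R/σ` — the near-contact NECKLACE channel priced by card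
`jensen-static-pressures` (`GapLipschitz`), cost `≈ 3 log(R/σT)` per link (Disproof 4(b), blob row
of the LD cost table, with which we agree). Stated in any real normed space (apply to lifts of
torus trajectories shorter than half the period).

(2) `HolderColours` — the generic finite Hölder/chessboard inequality (statement only; it is
`ENNReal.lintegral_prod_norm_pow_le` in disguise). It is the 27-colour decoupling step of the
cell-common variant in card `walled-cell-shadows`, AND the tool whose run-to-the-end over the
per-particle forecast worlds of one dependence cell is recorded there as VOID under `∀ δ`
(dead line (f) of that card; NOTES B2(b)).
-/

section RelayKinematics

variable {E : Type*} [NormedAddCommGroup E] [NormedSpace ℝ E]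

/-- RELAY KINEMATICS, meeting points: with `M k := x k + t k • v k` the scheduled meeting point of
link `k` on particle `k`'s free path, consecutive meeting points satisfy
`‖M (k+1) − M k‖ ≤ ε + w (t (k+1) − t k)`, hence by telescoping
`‖M (n+1) − M 1‖ ≤ n ε + w (t (n+1) − t 1)`. PROVED. -/
theorem relay_meeting_span (x v : ℕ → E) (t : ℕ → ℝ) (w ε : ℝ)
    (hw : ∀ k, ‖v k‖ ≤ w) (hmono : ∀ k, t k ≤ t (k + 1))
    (hmeet : ∀ k, ‖(x k + t (k + 1) • v k) - (x (k + 1) + t (k + 1) • v (k + 1))‖ ≤ ε) :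
    ∀ n : ℕ, ‖(x (n + 1) + t (n + 1) • v (n + 1)) - (x 1 + t 1 • v 1)‖
      ≤ n * ε + w * (t (n + 1) - t 1) := by
  intro n
  induction n with
  | zero => simp
  | succ n ih =>
    have h1 : ‖(x (n + 2) + t (n + 2) • v (n + 2)) - (x (n + 1) + t (n + 2) • v (n + 1))‖ ≤ ε := by
      rw [← norm_neg, neg_sub]
      exact hmeet (n + 1)
    have h2 : ‖(x (n + 1) + t (n + 2) • v (n + 1)) - (x (n + 1) + t (n + 1) • v (n + 1))‖
        ≤ w * (t (n + 2) - t (n + 1)) := by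
      have hrw : (x (n + 1) + t (n + 2) • v (n + 1)) - (x (n + 1) + t (n + 1) • v (n + 1))
          = (t (n + 2) - t (n + 1)) • v (n + 1) := by
        rw [sub_smul]; abel
      rw [hrw, norm_smul, Real.norm_eq_abs, abs_of_nonneg (sub_nonneg.2 (hmono (n + 1))),
        mul_comm]
      exact mul_le_mul_of_nonneg_right (hw _) (sub_nonneg.2 (hmono _))
    calc ‖(x (n + 1 + 1) + t (n + 1 + 1) • v (n + 1 + 1)) - (x 1 + t 1 • v 1)‖
        = ‖((x (n + 2) + t (n + 2) • v (n + 2)) - (x (n + 1) + t (n + 2) • v (n + 1)))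
          + ((x (n + 1) + t (n + 2) • v (n + 1)) - (x (n + 1) + t (n + 1) • v (n + 1)))
          + ((x (n + 1) + t (n + 1) • v (n + 1)) - (x 1 + t 1 • v 1))‖ := by
          congr 1; abel
      _ ≤ ε + w * (t (n + 2) - t (n + 1)) + (n * ε + w * (t (n + 1) - t 1)) :=
          (norm_add₃_le ..).trans (add_le_add (add_le_add h1 h2) ih)
      _ = ((n + 1 : ℕ) : ℝ) * ε + w * (t (n + 1 + 1) - t 1) := by push_cast; ring

/-- RELAY KINEMATICS, initial positions: if moreover all meeting times lie in `[0, T]`, every row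
member starts within `3 w T + (n+1) ε` of the anchor `p₀`:
`‖x (n+1) − x 0‖ ≤ 3 w T + (n+1) ε`. (Decompose
`x(n+1) − x 0 = (x(n+1) − M(n+1)) + (M(n+1) − M 1) + (M 1 − M'₁) + (M'₁ − x 0)` with
`M'₁ = x 0 + t 1 • v 0`.) PROVED. Consequence for the crux: relay rows corrupt forecasts only at
ranges `R ≤ 3 v_max T + σ·#links`. -/
theorem relay_span (x v : ℕ → E) (t : ℕ → ℝ) (w ε T : ℝ)
    (hw : ∀ k, ‖v k‖ ≤ w) (hmono : ∀ k, t k ≤ t (k + 1)) (ht0 : ∀ k, 0 ≤ t k)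
    (htT : ∀ k, t k ≤ T)
    (hmeet : ∀ k, ‖(x k + t (k + 1) • v k) - (x (k + 1) + t (k + 1) • v (k + 1))‖ ≤ ε) :
    ∀ n : ℕ, ‖x (n + 1) - x 0‖ ≤ 3 * w * T + (n + 1) * ε := by
  intro n
  have w0 : 0 ≤ w := (norm_nonneg _).trans (hw 0)
  have hM := relay_meeting_span x v t w ε hw hmono hmeet n
  -- the four pieces
  have hA : ‖x (n + 1) - (x (n + 1) + t (n + 1) • v (n + 1))‖ ≤ w * T := by
    rw [sub_add_cancel_left, norm_neg, norm_smul, Real.norm_eq_abs, abs_of_nonneg (ht0 _)]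
    calc t (n + 1) * ‖v (n + 1)‖ ≤ T * w :=
          mul_le_mul (htT _) (hw _) (norm_nonneg _) ((ht0 0).trans (htT 0))
      _ = w * T := mul_comm _ _
  have hC : ‖(x 1 + t 1 • v 1) - (x 0 + t 1 • v 0)‖ ≤ ε := by
    rw [← norm_neg, neg_sub]; exact hmeet 0
  have hD : ‖(x 0 + t 1 • v 0) - x 0‖ ≤ w * T := by
    rw [add_sub_cancel_left, norm_smul, Real.norm_eq_abs, abs_of_nonneg (ht0 _)]
    calc t 1 * ‖v 0‖ ≤ T * w := mul_le_mul (htT _) (hw _) (norm_nonneg _) ((ht0 0).trans (htT 0))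
      _ = w * T := mul_comm _ _
  have hB : ‖(x (n + 1) + t (n + 1) • v (n + 1)) - (x 1 + t 1 • v 1)‖ ≤ n * ε + w * T := by
    refine hM.trans (add_le_add le_rfl ?_)
    exact mul_le_mul_of_nonneg_left (by linarith [htT (n + 1), ht0 1]) w0
  calc ‖x (n + 1) - x 0‖
      = ‖(x (n + 1) - (x (n + 1) + t (n + 1) • v (n + 1)))
        + ((x (n + 1) + t (n + 1) • v (n + 1)) - (x 1 + t 1 • v 1))
        + ((x 1 + t 1 • v 1) - (x 0 + t 1 • v 0))
        + ((x 0 + t 1 • v 0) - x 0)‖ := by congr 1; abel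
    _ ≤ w * T + (n * ε + w * T) + ε + w * T := by
        refine (norm_add_le _ _).trans (add_le_add ((norm_add₃_le ..).trans ?_) hD)
        exact add_le_add (add_le_add hA hB) hC
    _ = 3 * w * T + (n + 1) * ε := by ring

end RelayKinematics

/-- GENERIC HÖLDER OVER COLOUR CLASSES (statement; card walled-cell-shadows): for a probability
measure and finitely many measurable real functions `f c`,
`∫ exp(∑_c f_c) dμ ≤ ∏_c (∫ exp(K · f_c) dμ)^{1/K}`, `K` = number of classes. Used over the `27`
chessboard colours of `(2R + 2r_s)`-cells (same-colour cells carry conditionally independent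
forecast worlds, DLR) in the CELL-COMMON variant. Run over the `≍ 64ρR³` per-particle worlds of a
`4R`-cell instead, it multiplies `lam` by the cell population while each world's failure
probability is only `e^{-cR²/T²θ}`: the feasibility window is `lam ≲ 10⁻⁷/(T³√log(1/δ))`, void
under `∀ δ` — recorded as a dead line, not a lemma of the line.
(`ENNReal.lintegral_prod_norm_pow_le` with exponents `1/K`.) -/
def HolderColours : Prop :=
  ∀ (α : Type) [MeasurableSpace α] (μ : Measure α), IsProbabilityMeasure μ →
    ∀ (K : ℕ), 0 < K → ∀ (f : Fin K → α → ℝ), (∀ c, Measurable (f c)) →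
      ∫⁻ a, ENNReal.ofReal (Real.exp (∑ c, f c a)) ∂μ
        ≤ ∏ c, (∫⁻ a, ENNReal.ofReal (Real.exp (K * f c a)) ∂μ) ^ (1 / (K : ℝ))

end Summit.AtomisticToContinuum.HydrodynamicLimit.Cruxes.InfluenceLocality.Ideator1
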